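import Literature.NumberTheory.EllipticCurves.Rank1Residual.Typed.Basic
import Literature.NumberTheory.EllipticCurves.Castella2018.PAdicWaldspurgerFormula
import Summits.BirchSwinnertonDyer.Rank1Residual.X11b.AnticyclotomicEmbedding
import Summits.BirchSwinnertonDyer.Rank1Residual.X11b.HalvesReceptacle
import Summits.BirchSwinnertonDyer.Rank1Residual.X11b.RouteR1BDPValue
import Literature.NumberTheory.EllipticCurves.ZpExtensionAnticyclotomicHoldsProofs
import Literature.NumberTheory.EllipticCurves.UnrIntegersUnits
import Literature.FieldTheory.AlgClosed.PadicAlgClEquivComplex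
import Literature.NumberTheory.EllipticCurves.KrausOesterle1992.TorsionCongruenceCriterionHasseWeilProofs
import Summits.BirchSwinnertonDyer.BirchSwinnertonDyer.Theorems.ErratumRoadFiveValueByNormContinuity
import Literature.NumberTheory.EllipticCurves.BDPValueContinuityMultiplicativePrime
import Summits.BirchSwinnertonDyer.BirchSwinnertonDyer.Theorems.ErratumRoadFiveOpenInputNotRamBDPFrameDescentStub
import Literature.NumberTheory.EllipticCurves.StrictSelmerRankOneDegreeOneProofs
import HarnessLib

/-!
# The BSTW door for `KatoValuationIneqNonsplitAtFive` — A♯: the BDP frame and its Waldspurger value on ALL of X11b (hosted)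
# (crux stmt-BirchSwinnertonDyer-19715, (α2) item stmt-BirchSwinnertonDyer-33169 `ErratumRoadFive.KatoValuationIneqNonsplitAtFive`)

LEAD `bsd-line-er5-p1` g20 (pen word `d2R` P1, 2026-08-31T03:03:23Z: «the composition that reaches the ν-free crux BY NAME»).
`Cruxes/**` modules are not built, so the sorry-free EXPONENT-FREE half A♯ of idea-9's door
`Cruxes/KatoValuationIneqNonsplitAtFive/Lines/bstw_door.lean` (registry r2 a6e65636170da625, §1, l.448–1006) is HOSTED here
as a built module, proofs VERBATIM, with the door's S0′ conjuncts it consumes — the refereed pair (H14)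
`hsieh2014_exists_anticyclotomicPAdicLFunction_unrPeriod` ∧ (R) `bertoliniDarmonPrasanna2013_centralValue_reciprocity`, and
`thm32_exists_isBDPLFunction_valueAtOne`, `castella2018Exceptional_bdpValueContinuity_trivialChar` — taken as NAMED-FACT
HYPOTHESES (D-0014 pattern) instead of the door's sorried stub `stub_printedFactsHeldNonsplit`; the intro'd Heegner
hypothesis is renamed `hHg` where it clashed.  Contents: `bdpFramePrintMultiplicative_of_descent` (A♯-print: the BDP frame at a
MULTIPLICATIVE prime, ANY conductor, by the cell's `R₀`-descent `exists_isBDPLFunction_of_hsieh2014_unrPeriod_of_bdp2013`),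
`bdpFrame_of_print` (the door-data frame), `bdpFrameValue_of_frame` (the VALUE clause from Castella's value continuity +
one-sided norm rigidity), `bdpFrameValue_of_thm32` ∕ `bdpFrameValue_of_semistable` (semistable members from Cas18 Thms. 3.1–3.2),
`bdpFrameValue` (ALL of X11b, by cases).  Consumed by `ErratumRoadFiveBstwDoorCrossingR` (the crossing at an abstract exponent)
and `ErratumRoadFiveBstwDoorValuationIneqR` (the cores and the by-name entry point on the amended exponent R).
No registered stub, no crux and no summit statement is proved here; typed ≠ proved; BSD is proved for no curve.
-/

set_option autoImplicit false
-- D-0017: single-problem summit, so `Summit.BirchSwinnertonDyer.BirchSwinnertonDyer.…` repeats a namespace BY DESIGN.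
set_option linter.dupNamespace false

noncomputable section

open scoped Classical NumberField TensorProduct BigOperators

namespace Summit.BirchSwinnertonDyer.BirchSwinnertonDyer.Theorems.ErratumRoadFiveBstwDoor

open Field
open Literature.NumberTheory.GaloisRepresentations
open Literature.NumberTheory.EllipticCurves Literature.NumberTheory.EllipticCurves.Kato2004
open Literature.NumberTheory.EllipticCurves.Kato2004.EulerSystemValues
open Literature.NumberTheory.EllipticCurves.Rank1Residual
open Literature.NumberTheory.EllipticCurves.Rank1Residual.Typed
open Literature.NumberTheory.EllipticCurves.ModularForms
open Literature.NumberTheory.EllipticCurves.Castella2018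
open Summit.BirchSwinnertonDyer.Rank1Residual
open Summit.BirchSwinnertonDyer.BirchSwinnertonDyer.Theorems
open IsDedekindDomain (HeightOneSpectrum)
open CongruenceSubgroup (Gamma0)

/-! ## §1 A♯-print: the BDP frame at a multiplicative prime, any conductor (door l.403–473) -/

/-- **A♯-print — the BDP anticyclotomic `p`-adic `L`-function FRAME at a MULTIPLICATIVE prime, ANY conductor** (door
`bdpFramePrintMultiplicative_of_descent`, rev 3.9): PROVED from the refereed pair (H14) Hsieh 2014 Thm. A ∕ Thms. 5.6–5.7
(`hsieh2014_exists_anticyclotomicPAdicLFunction_unrPeriod`) ∧ (R) BDP13 Thm. 5.5 (`bertoliniDarmonPrasanna2013_centralValue_reciprocity`)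
by the cell's `R₀`-DESCENT `exists_isBDPLFunction_of_hsieh2014_unrPeriod_of_bdp2013` (nram2 g2) and three lines of plumbing
(`p ∥ N` from multiplicative reduction; `p` split from the all-split Heegner hypothesis; `e(𝔭|p) = f(𝔭|p) = 1`).  The statement
is A206 `castella2018_exists_isBDPLFunction` with `Squarefree N` replaced by Castella 2024 §2.1's standing hypotheses.
[cite: Castella2024, §2.1 (arXiv:2409.01360 p. 5) and §2.3 (p. 6)] [cite: Castella2018, Thm. 3.1 (arXiv:1704.06608 p. 9)]
[cite: Hsieh2014, Thm. A (p. 712) and Thms. 5.6–5.7] [cite: BertoliniDarmonPrasanna2013, Thm. 5.5 and (5.1.16) (p. 60)] -/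
theorem bdpFramePrintMultiplicative_of_descent (hH14 : hsieh2014_exists_anticyclotomicPAdicLFunction_unrPeriod)
    (hBDP13 : bertoliniDarmonPrasanna2013_centralValue_reciprocity) :
    ∀ {p : ℕ} [Fact p.Prime] (ι : PadicAlgCl p ≃+* ℂ) (W : WeierstrassCurve ℚ) [W.IsElliptic]
      (K : Type) [Field K] [NumberField K] (𝔭 : IsDedekindDomain.HeightOneSpectrum (𝓞 K))
      (κ : ZpExtension K p) (γ : absoluteGaloisGroup K) {N : ℕ} [NeZero N]
      {f : CuspForm (CongruenceSubgroup.Gamma0 N) 2} (_ : IsNewformOf W f),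
      5 ≤ p → W.conductorNorm ℤ = N → W.HasMultiplicativeReductionAtPrime p → W.HasIrreducibleModPGaloisRep p →
      IsImaginaryQuadratic K → Odd (NumberField.discr K) → NumberField.discr K < -4 →
      (∀ ℓ : ℕ, ℓ.Prime → ℓ ∣ N → ((Ideal.span {(ℓ : ℤ)}).primesOver (𝓞 K)).ncard = 2) →
      ((p : ℕ) : 𝓞 K) ∈ 𝔭.asIdeal →
      (∀ (w : NumberField.InfinitePlace K) (k : 𝓞 K), k ∈ 𝔭.asIdeal ↔ ‖ι.symm (w.embedding (k : K))‖ < 1) →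
      κ.IsAnticyclotomic → κ.IsTopGenerator γ →
      ∃ (ΩK : ℂ) (Ωp : (unrIntegers p)ˣ) (L : UnrSeries p),
        ΩK ≠ 0 ∧ IsBDPLFunction ι 𝔭 κ γ f ΩK ((Ωp : unrIntegers p) : ℂ_[p]) L := by
  intro p _ ι W _ K _ _ 𝔭 κ γ N _ f hf h5 hN hmult _hirr hK hodd _hd4 hHeeg hp𝔭 hι hκ hγ
  have hp : p.Prime := Fact.out
  have hp2 : p ≠ 2 := by omega
  -- plumbing: `p ∥ N` from multiplicative reduction; `p` split (Heegner at `ℓ = p`); `e(𝔭|p) = f(𝔭|p) = 1`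
  have hpN : p ∣ N := hN ▸ X11b.dvd_conductorNorm_of_mult hmult
  have hp2N : ¬ p ^ 2 ∣ N := hN ▸ X11b.not_sq_dvd_conductorNorm_of_mult W p hmult
  obtain ⟨hram, hdeg⟩ :=
    ramificationIdx_eq_one_and_inertiaDeg_eq_one_of_ncard_primesOver_eq_two p hK.1 (hHeeg p hp hpN) 𝔭 hp𝔭
  -- the cell's `R₀`-descent of Hsieh's `𝒪_{ℂ_p}`-frame (nram2 g2, 2026-08-26)
  exact exists_isBDPLFunction_of_hsieh2014_unrPeriod_of_bdp2013 hH14 hBDP13 hp2 ι W K 𝔭 κ γ hf hN hpN hp2N hK hodd hHeeg hp𝔭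
    hram hdeg hι hκ hγ

/-! ## §2 The door-data frame and its value (door l.486–739, l.943–1006) -/

/-- **A♯-frame — a THEOREM of A♯-print** (door `bdpFrame_of_print`): for `(E, p)` in X11b, `p ≥ 5`, a Heegner field `L` for `N_E`
(every `ℓ ∣ N_E` split — so `p` splits) with `d_L` odd `< −4`, a newform datum `Dt` and the place `w₀`: THE anticyclotomic
`ℤ_p`-extension with a topological generator, a degree-one prime `𝔭 ∣ p` with THE embedding `X11b.embAt` inducing it,
`𝔭 = 𝔭_{ι′}` for `ι′ ∈ {ι₀, ι₀ ∘ conj}`, and the print-shaped frame at these data.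
[cite: Castella2024, §2.3 (arXiv:2409.01360 p. 6)] [cite: Castella2018, Thm. 3.1 (arXiv:1704.06608 p. 9)] -/
theorem bdpFrame_of_print (hH14 : hsieh2014_exists_anticyclotomicPAdicLFunction_unrPeriod)
    (hBDP13 : bertoliniDarmonPrasanna2013_centralValue_reciprocity) {p : ℕ} [Fact p.Prime] (ι₀ : PadicAlgCl p ≃+* ℂ) :
    ∀ (W : WeierstrassCurve ℚ) [W.IsElliptic] [W.IsGloballyMinimal] [NeZero (W.conductorNorm ℤ)],
      ClassX11b W p → 5 ≤ p →
      ∀ (L : Type) [Field L] [NumberField L], IsImaginaryQuadratic L →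
        SatisfiesHeegnerHypothesis (W.conductorNorm ℤ) L → NumberField.discr L < -4 → Odd (NumberField.discr L) →
      ∀ (Dt : ModularParametrizationData W (W.conductorNorm ℤ)) (w₀ : NumberField.InfinitePlace L),
      ∃ (ι' : PadicAlgCl p ≃+* ℂ) (e : L →+* ℚ_[p])
        (κ : ZpExtension L p) (γ : absoluteGaloisGroup L) (ΩK : ℂ) (Ωp : (unrIntegers p)ˣ) (Λf : UnrSeries p),
        (∀ x : 𝓞 L, x ∈ (X11b.primeOfEmbeddingDatum p ι' w₀.embedding).asIdeal ↔ ‖e (x : L)‖ < 1) ∧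
        κ.IsAnticyclotomic ∧ κ.IsTopGenerator γ ∧ ΩK ≠ 0 ∧
        IsBDPLFunction ι' (X11b.primeOfEmbeddingDatum p ι' w₀.embedding) κ γ Dt.f ΩK
          ((Ωp : unrIntegers p) : ℂ_[p]) Λf := by
  intro W _ _ _ hX h5 L _ _ hLq hH hd4 hodd Dt w₀
  have hp : p.Prime := Fact.out
  have hpN : p ∣ W.conductorNorm ℤ :=
    (W.dvd_conductorNorm_iff_not_hasGoodReductionAtPrime p).mpr
      (WeierstrassCurve.HasMultiplicativeReduction.not_hasGoodReduction (R := ℤ_[p]) hX.2.2.1)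
  have hirr : Irr W p := hX.2.2.2
  have hsp : X11b.SplitsIn L p := hH p hp hpN
  -- THE anticyclotomic `ℤ_p`-extension and a topological generator
  have himag : ∀ w : NumberField.InfinitePlace L, w.IsComplex := fun w ↦ hLq.2.isComplex w
  obtain ⟨κ, hκ⟩ := ZpExtension.exists_isAnticyclotomic_holds (K := L) (p := p) hLq.1 himag
  obtain ⟨γ, hγ⟩ : ∃ γ : absoluteGaloisGroup L, κ.IsTopGenerator γ := κ.surjective (Multiplicative.ofAdd 1)
  -- a degree-one prime above the split `p`; it is `𝔭_{ι′}` for `ι′ ∈ {ι₀, ι₀ ∘ conj}`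
  obtain ⟨𝔭, h𝔭, he1, hf1⟩ := X11b.exists_degreeOnePrime_of_splitsIn L p hLq.1 hsp
  have key : ∀ ι' : PadicAlgCl p ≃+* ℂ, 𝔭 = X11b.primeOfEmbeddingDatum p ι' w₀.embedding →
      ∃ (ι' : PadicAlgCl p ≃+* ℂ) (e : L →+* ℚ_[p])
        (κ : ZpExtension L p) (γ : absoluteGaloisGroup L) (ΩK : ℂ) (Ωp : (unrIntegers p)ˣ) (Λf : UnrSeries p),
        (∀ x : 𝓞 L, x ∈ (X11b.primeOfEmbeddingDatum p ι' w₀.embedding).asIdeal ↔ ‖e (x : L)‖ < 1) ∧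
        κ.IsAnticyclotomic ∧ κ.IsTopGenerator γ ∧ ΩK ≠ 0 ∧
        IsBDPLFunction ι' (X11b.primeOfEmbeddingDatum p ι' w₀.embedding) κ γ Dt.f ΩK
          ((Ωp : unrIntegers p) : ℂ_[p]) Λf := by
    intro ι' h𝔭eq
    subst h𝔭eq
    have hemb : ∀ x : 𝓞 L, x ∈ (X11b.primeOfEmbeddingDatum p ι' w₀.embedding).asIdeal ↔
        ‖X11b.embAt L p _ h𝔭 he1 hf1 (x : L)‖ < 1 :=
      X11b.mem_asIdeal_iff_norm_embAt_lt_one _ h𝔭 he1 hf1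
    obtain ⟨ΩK, Ωp, Λf, hΩ, hL⟩ :=
      bdpFramePrintMultiplicative_of_descent hH14 hBDP13 ι' W L (X11b.primeOfEmbeddingDatum p ι' w₀.embedding) κ γ Dt.isNewformOf h5 rfl
        hX.2.2.1 hirr hLq hodd hd4
        (fun ℓ hℓ hℓN ↦ hH ℓ hℓ hℓN) (X11b.natCast_mem_primeOfEmbeddingDatum p ι' w₀.embedding)
        (X11b.forall_mem_primeOfEmbeddingDatum_iff p ι' hLq w₀) hκ hγ
    exact ⟨ι', X11b.embAt L p _ h𝔭 he1 hf1, κ, γ, ΩK, Ωp, Λf, hemb, hκ, hγ, hΩ, hL⟩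
  rcases X11b.eq_primeOfEmbeddingDatum_or_eq_trans_starRingAut p ι₀ hLq w₀ h𝔭 with h | h
  · exact key ι₀ h
  · exact key _ h

/-- **A♯-res — the VALUE clause from the frame + PRINT** (door `bdpFrameValue_of_frame`): for a NON-semistable member, a Heegner
presentation `(Dt, Hd, w₀, P_L)` with `p ∤ c(Dt)` and `P_L` of INFINITE ORDER, the frame of `bdpFrame_of_print` carries the
`p`-adic Waldspurger value `L_𝔭(f)(𝟙) = u·((1 − a_p p⁻¹)·log_ω e(P_L)/c)²`, `u ∈ R₀^×`: Castella's VALUE CONTINUITY at `𝟙` for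
`p ∥ N`, ANY conductor (`castella2018Exceptional_bdpValueContinuity_trivialChar`, via `tendsto_norm_bdpInterpolationValue_of_valueContinuity`),
ONE-SIDED NORM RIGIDITY in `𝓞_{ℂ_p}⟦T⟧` (`intSeries_norm_constantCoeff_eq_of_isBDPLFunctionInt_of_continuousNorms`), `‖c‖_p = 1`,
and `exists_unit_unrIntegers_mul_eq_of_norm_eq`.
[cite: Castella2018Exceptional, Thms. 2.10–2.11 (arXiv:1507.04260 pp. 13–14)] [cite: Castella2018, Thm. 3.2 with (3.2) (arXiv:1704.06608 p. 9)] -/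
theorem bdpFrameValue_of_frame (hVC : castella2018Exceptional_bdpValueContinuity_trivialChar)
    (hH14 : hsieh2014_exists_anticyclotomicPAdicLFunction_unrPeriod)
    (hBDP13 : bertoliniDarmonPrasanna2013_centralValue_reciprocity) :
    ∀ (W : WeierstrassCurve ℚ) [W.IsElliptic] [W.IsGloballyMinimal] (p : ℕ) [Fact p.Prime]
      [NeZero (W.conductorNorm ℤ)],
      ClassX11b W p → 5 ≤ p → ¬ Semistable W → Surj W p →
      ∀ (L : Type) [Field L] [NumberField L], IsImaginaryQuadratic L →
        SatisfiesHeegnerHypothesis (W.conductorNorm ℤ) L → SatisfiesHeegnerHypothesis p L →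
        NumberField.discr L < -4 → Odd (NumberField.discr L) →
      ∀ (Dt : ModularParametrizationData W (W.conductorNorm ℤ))
        (Hd : HeegnerDatum (W.conductorNorm ℤ) (NumberField.discr L)) (w₀ : NumberField.InfinitePlace L)
        (PL : (W.baseChange L).toAffine.Point),
        WeierstrassCurve.Affine.Point.map w₀.embedding.toRatAlgHom PL = heegnerPointComplex Dt Hd →
        ¬ (p : ℤ) ∣ Dt.c → ¬ IsOfFinAddOrder PL →
      ∃ (ι' : PadicAlgCl p ≃+* ℂ) (e : L →+* ℚ_[p])
        (κ : ZpExtension L p) (γ : absoluteGaloisGroup L) (ΩK : ℂ) (Ωp : (unrIntegers p)ˣ) (Λf : UnrSeries p),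
        (∀ x : 𝓞 L, x ∈ (X11b.primeOfEmbeddingDatum p ι' w₀.embedding).asIdeal ↔ ‖e (x : L)‖ < 1) ∧
        κ.IsAnticyclotomic ∧ κ.IsTopGenerator γ ∧ ΩK ≠ 0 ∧
        IsBDPLFunction ι' (X11b.primeOfEmbeddingDatum p ι' w₀.embedding) κ γ Dt.f ΩK
          ((Ωp : unrIntegers p) : ℂ_[p]) Λf ∧
        ∃ u : (unrIntegers p)ˣ, Λf.HasValueAt 0
          (((u : unrIntegers p) : ℂ_[p]) *
            (algebraMap ℚ_[p] ℂ_[p]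
              (((1 : ℚ_[p]) - (W.LFunction p : ℚ_[p]) * (p : ℚ_[p])⁻¹) * padicLogOmega W p e PL /
                (Dt.c : ℚ_[p]))) ^ 2) := by
  intro W _ _ p _ _ hX h5 _hss _ L _ _ hLq hHg hHp hd4 hodd Dt Hd w₀ PL hPL hc hinf
  have hp : p.Prime := Fact.out
  have hp2 : p ≠ 2 := by omega
  -- the frame: an `R₀`-frame of `(f, L, p)` from the print-shaped stub A♯-print (Steinitz for `ι₀`)
  obtain ⟨ι₀⟩ := PadicAlgCl.nonempty_ringEquiv_complex p
  obtain ⟨ι', e, κ, γ, ΩK, Ωp, Λf, he, hκ, hγ, hΩK, hL⟩ :=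
    bdpFrame_of_print hH14 hBDP13 ι₀ W hX h5 L hLq hHg hd4 hodd Dt w₀
  -- the named fact at these data; its sign clause is VACUOUS (every `ℓ ∣ N` splits in `L`, so `ℓ ∤ d_L`)
  have hsign : ∀ (ℓ : ℕ) [Fact ℓ.Prime], ℓ ∣ W.conductorNorm ℤ → (ℓ : ℤ) ∣ NumberField.discr L →
      W.HasMultiplicativeReductionAtPrime ℓ ∧ ¬ W.HasSplitMultiplicativeReductionAtPrime ℓ := by
    intro ℓ _ hℓN hℓD
    exact absurd hℓD (X11b.not_dvd_discr_of_splitsIn hLq.1 Fact.out (hHg ℓ Fact.out hℓN))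
  obtain ⟨ΩK', Ωp', hΩK', hΩp', hcont⟩ :=
    tendsto_norm_bdpInterpolationValue_of_valueContinuity hVC ι' W L
      (X11b.primeOfEmbeddingDatum p ι' w₀.embedding) κ γ Dt Hd w₀ e PL h5 rfl hX.2.2.1 hLq hodd (by omega)
      (hHp p hp dvd_rfl) (X11b.natCast_mem_primeOfEmbeddingDatum p ι' w₀.embedding)
      (X11b.forall_mem_primeOfEmbeddingDatum_iff p ι' hLq w₀)
      (fun ℓ hℓ hℓN ↦ X11b.exists_absNorm_eq_of_splitsIn hLq.1 hℓ (hHg ℓ hℓ hℓN))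
      (fun ℓ _ hℓN hℓD ↦ hsign ℓ hℓN hℓD) hκ hγ hc hPL he
  -- the target norm is `≠ 0`: `a_p = ±1`, `log_ω e(P_L) ≠ 0` (`P_L` of infinite order)
  have hΩp0 : ((Ωp : unrIntegers p) : ℂ_[p]) ≠ 0 := by
    rw [Ne, ZeroMemClass.coe_eq_zero]
    exact Units.ne_zero Ωp
  have ha : W.LFunction p = 1 ∨ W.LFunction p = -1 :=
    KrausOesterle1992.lFunction_apply_prime_eq_one_or_eq_neg_one_of_mult W p hX.2.2.1
  have hp0 : (0 : ℝ) < p := by exact_mod_cast hp.pos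
  have heul0 : (1 : ℚ_[p]) - (W.LFunction p : ℚ_[p]) * (p : ℚ_[p])⁻¹ ≠ 0 := by
    intro h0
    have hn := X11b.Halves.norm_one_sub_div_eq p ha
    rw [h0, norm_zero] at hn
    exact hp0.ne hn
  have hlog0 : padicLogOmega W p e PL ≠ 0 := by
    rw [← X11b.R1.logOmega_eq_padicLogOmega]
    exact X11b.R1.logOmega_ne_zero W p e hinf
  set z : ℚ_[p] := ((1 : ℚ_[p]) - (W.LFunction p : ℚ_[p]) * (p : ℚ_[p])⁻¹) * padicLogOmega W p e PL with hz
  have hz0 : z ≠ 0 := mul_ne_zero heul0 hlog0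
  have hN0 : ‖algebraMap ℚ_[p] ℂ_[p] z‖ ^ 2 ≠ 0 :=
    pow_ne_zero _ (norm_ne_zero_iff.mpr ((map_ne_zero_iff _ (algebraMap ℚ_[p] ℂ_[p]).injective).mpr hz0))
  -- one-sided norm rigidity in `𝓞_{ℂ_p}⟦T⟧`: `‖[T⁰]Λf‖ = ‖z‖²`
  have hQ := X11b.R1.isBDPLFunctionInt_map hL
  have key :=
    Summit.BirchSwinnertonDyer.BirchSwinnertonDyer.Theorems.intSeries_norm_constantCoeff_eq_of_isBDPLFunctionInt_of_continuousNorms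
      hp2 hLq hκ hγ hΩK' hΩK hΩp' hΩp0 hcont hN0 hQ
  have hcoe : ((PowerSeries.constantCoeff (PowerSeries.map (X11b.R1.unrToCpInt p) Λf) : 𝓞_ℂ_[p]) : ℂ_[p]) =
      ((PowerSeries.constantCoeff Λf : unrIntegers p) : ℂ_[p]) := by
    rw [← PowerSeries.coeff_zero_eq_constantCoeff_apply, PowerSeries.coeff_map,
      PowerSeries.coeff_zero_eq_constantCoeff_apply, X11b.R1.coe_unrToCpInt]
  rw [hcoe] at key
  -- `c` is a `p`-adic unit, so `‖(z/c)²‖ = ‖z‖²`, and an element of `R₀` of that norm is a unit multiple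
  have hcQ1 : ‖((Dt.c : ℤ) : ℚ_[p])‖ = 1 := by
    rcases (Padic.norm_int_le_one (p := p) Dt.c).eq_or_lt with h | h
    · exact h
    · exact absurd (Padic.norm_intCast_lt_one_iff.mp h) hc
  have hc0 : ((Dt.c : ℤ) : ℚ_[p]) ≠ 0 := by
    intro h0; rw [h0, norm_zero] at hcQ1; exact zero_ne_one hcQ1
  have hx0 : (z / (Dt.c : ℚ_[p])) ^ 2 ≠ 0 := pow_ne_zero _ (div_ne_zero hz0 hc0)
  have hnorm : ‖((PowerSeries.constantCoeff Λf : unrIntegers p) : ℂ_[p])‖ =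
      ‖algebraMap ℚ_[p] ℂ_[p] ((z / (Dt.c : ℚ_[p])) ^ 2)‖ := by
    rw [key, norm_algebraMap', norm_algebraMap', norm_pow, norm_div, hcQ1, div_one]
  obtain ⟨u, hu⟩ :=
    Summit.BirchSwinnertonDyer.BirchSwinnertonDyer.Theorems.exists_unit_unrIntegers_mul_eq_of_norm_eq
      (PowerSeries.constantCoeff Λf) hx0 hnorm
  refine ⟨ι', e, κ, γ, ΩK, Ωp, Λf, he, hκ, hγ, hΩK, hL, u, ?_⟩
  rw [map_pow] at hu
  rw [hu]
  exact Λf.hasValueAt_zero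

/-- **A♯ for SEMISTABLE curves and `p ∤ c`, from the NAMED FACT** `Castella2018.thm32_exists_isBDPLFunction_valueAtOne`
(door `bdpFrameValue_of_thm32`; Steinitz datum `ι₀` an input; the `p`-UNIT `c²` absorbed into `u`).
[cite: Castella2018, Thm. 3.1, Thm. 3.2 with (3.2) (arXiv:1704.06608 p. 9)] -/
theorem bdpFrameValue_of_thm32 (h32 : thm32_exists_isBDPLFunction_valueAtOne)
    {p : ℕ} [Fact p.Prime] (ι₀ : PadicAlgCl p ≃+* ℂ) :
    ∀ (W : WeierstrassCurve ℚ) [W.IsElliptic] [W.IsGloballyMinimal] [NeZero (W.conductorNorm ℤ)],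
      ClassX11b W p → 5 ≤ p → Semistable W →
      ∀ (L : Type) [Field L] [NumberField L], IsImaginaryQuadratic L →
        SatisfiesHeegnerHypothesis (W.conductorNorm ℤ) L → SatisfiesHeegnerHypothesis p L →
      ∀ (Dt : ModularParametrizationData W (W.conductorNorm ℤ))
        (Hd : HeegnerDatum (W.conductorNorm ℤ) (NumberField.discr L)) (w₀ : NumberField.InfinitePlace L)
        (PL : (W.baseChange L).toAffine.Point), ¬ (p : ℤ) ∣ Dt.c →
        WeierstrassCurve.Affine.Point.map w₀.embedding.toRatAlgHom PL = heegnerPointComplex Dt Hd →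
      ∃ (ι' : PadicAlgCl p ≃+* ℂ) (e : L →+* ℚ_[p])
        (κ : ZpExtension L p) (γ : absoluteGaloisGroup L) (ΩK : ℂ) (Ωp : (unrIntegers p)ˣ) (Λf : UnrSeries p),
        (∀ x : 𝓞 L, x ∈ (X11b.primeOfEmbeddingDatum p ι' w₀.embedding).asIdeal ↔ ‖e (x : L)‖ < 1) ∧
        κ.IsAnticyclotomic ∧ κ.IsTopGenerator γ ∧ ΩK ≠ 0 ∧
        IsBDPLFunction ι' (X11b.primeOfEmbeddingDatum p ι' w₀.embedding) κ γ Dt.f ΩK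
          ((Ωp : unrIntegers p) : ℂ_[p]) Λf ∧
        ∃ u : (unrIntegers p)ˣ, Λf.HasValueAt 0
          (((u : unrIntegers p) : ℂ_[p]) *
            (algebraMap ℚ_[p] ℂ_[p]
              (((1 : ℚ_[p]) - (W.LFunction p : ℚ_[p]) * (p : ℚ_[p])⁻¹) * padicLogOmega W p e PL /
                (Dt.c : ℚ_[p]))) ^ 2) := by
  intro W _ _ _ hX h5 hss L _ _ hLq hH hHp Dt Hd w₀ PL hc hPL
  have hp : p.Prime := Fact.out
  have hpN : p ∣ W.conductorNorm ℤ :=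
    (W.dvd_conductorNorm_iff_not_hasGoodReductionAtPrime p).mpr
      (WeierstrassCurve.HasMultiplicativeReduction.not_hasGoodReduction (R := ℤ_[p]) hX.2.2.1)
  have hirr : Irr W p := hX.2.2.2
  have hsp : X11b.SplitsIn L p := hHp p hp dvd_rfl
  -- THE anticyclotomic `ℤ_p`-extension and a topological generator
  have himag : ∀ w : NumberField.InfinitePlace L, w.IsComplex := fun w ↦ hLq.2.isComplex w
  obtain ⟨κ, hκ⟩ := ZpExtension.exists_isAnticyclotomic_holds (K := L) (p := p) hLq.1 himag
  obtain ⟨γ, hγ⟩ : ∃ γ : absoluteGaloisGroup L, κ.IsTopGenerator γ := κ.surjective (Multiplicative.ofAdd 1)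
  -- a degree-one prime above the split `p`; it is `𝔭_{ι′}` for `ι′ ∈ {ι₀, ι₀ ∘ conj}`
  obtain ⟨𝔭, h𝔭, he1, hf1⟩ := X11b.exists_degreeOnePrime_of_splitsIn L p hLq.1 hsp
  -- `c` is a `p`-adic unit
  have hcQ1 : ‖((Dt.c : ℤ) : ℚ_[p])‖ = 1 := by
    rcases (Padic.norm_int_le_one (p := p) Dt.c).eq_or_lt with h | h
    · exact h
    · exact absurd (Padic.norm_intCast_lt_one_iff.mp h) hc
  have hcC : ‖((Dt.c : ℤ) : ℂ_[p])‖ = 1 := by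
    rw [← map_intCast (algebraMap ℚ_[p] ℂ_[p]), norm_algebraMap', hcQ1]
  have hc0 : ((Dt.c : ℤ) : ℂ_[p]) ≠ 0 := by
    intro h0; rw [h0, norm_zero] at hcC; exact zero_ne_one hcC
  obtain ⟨uc, huc⟩ := (unrIntegers.isUnit_iff_norm_eq_one
    (⟨((Dt.c : ℤ) : ℂ_[p]), intCast_mem_unrIntegers Dt.c⟩ : unrIntegers p)).mpr hcC
  have huc' : ((uc : unrIntegers p) : ℂ_[p]) = ((Dt.c : ℤ) : ℂ_[p]) := by rw [huc]
  have key : ∀ ι' : PadicAlgCl p ≃+* ℂ, 𝔭 = X11b.primeOfEmbeddingDatum p ι' w₀.embedding →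
      ∃ (ι' : PadicAlgCl p ≃+* ℂ) (e : L →+* ℚ_[p])
        (κ : ZpExtension L p) (γ : absoluteGaloisGroup L) (ΩK : ℂ) (Ωp : (unrIntegers p)ˣ) (Λf : UnrSeries p),
        (∀ x : 𝓞 L, x ∈ (X11b.primeOfEmbeddingDatum p ι' w₀.embedding).asIdeal ↔ ‖e (x : L)‖ < 1) ∧
        κ.IsAnticyclotomic ∧ κ.IsTopGenerator γ ∧ ΩK ≠ 0 ∧
        IsBDPLFunction ι' (X11b.primeOfEmbeddingDatum p ι' w₀.embedding) κ γ Dt.f ΩK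
          ((Ωp : unrIntegers p) : ℂ_[p]) Λf ∧
        ∃ u : (unrIntegers p)ˣ, Λf.HasValueAt 0
          (((u : unrIntegers p) : ℂ_[p]) *
            (algebraMap ℚ_[p] ℂ_[p]
              (((1 : ℚ_[p]) - (W.LFunction p : ℚ_[p]) * (p : ℚ_[p])⁻¹) * padicLogOmega W p e PL /
                (Dt.c : ℚ_[p]))) ^ 2) := by
    intro ι' h𝔭eq
    subst h𝔭eq
    have hemb : ∀ x : 𝓞 L, x ∈ (X11b.primeOfEmbeddingDatum p ι' w₀.embedding).asIdeal ↔
        ‖X11b.embAt L p _ h𝔭 he1 hf1 (x : L)‖ < 1 :=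
      X11b.mem_asIdeal_iff_norm_embAt_lt_one _ h𝔭 he1 hf1
    obtain ⟨ΩK, Ωp, Λf, hΩ, hL, u, hu⟩ :=
      X11b.R1.exists_frame_bdpValueAtOneOnTreeAt_of_satisfiesHeegnerHypothesis h32 ι' Dt Hd h5 hss hirr hpN
        hLq hH hc w₀ hPL κ hκ γ hγ hemb
    refine ⟨ι', X11b.embAt L p _ h𝔭 he1 hf1, κ, γ, ΩK, Ωp, Λf, hemb, hκ, hγ, hΩ, hL, u * uc ^ 2, ?_⟩
    rw [X11b.R1.logOmega_eq_padicLogOmega] at hu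
    convert hu using 1
    rw [Units.val_mul, Units.val_pow_eq_pow_val, Subring.coe_mul, Subring.coe_pow, huc', map_div₀,
      map_intCast, div_pow]
    field_simp
  rcases X11b.eq_primeOfEmbeddingDatum_or_eq_trans_starRingAut p ι₀ hLq w₀ h𝔭 with h | h
  · exact key ι₀ h
  · exact key _ h

/-- **A♯ on the SEMISTABLE members of X11b is print** (door `bdpFrameValue_of_semistable`): from `thm32` alone, the embedding
datum by `PadicAlgCl.nonempty_ringEquiv_complex` (Steinitz). [cite: Castella2018, Thm. 3.1 and Thm. 3.2 (arXiv:1704.06608 p. 9)] -/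
theorem bdpFrameValue_of_semistable (h32 : thm32_exists_isBDPLFunction_valueAtOne) :
    ∀ (W : WeierstrassCurve ℚ) [W.IsElliptic] [W.IsGloballyMinimal] (p : ℕ) [Fact p.Prime]
      [NeZero (W.conductorNorm ℤ)],
      ClassX11b W p → 5 ≤ p → Semistable W → Surj W p →
      ∀ (L : Type) [Field L] [NumberField L], IsImaginaryQuadratic L →
        SatisfiesHeegnerHypothesis (W.conductorNorm ℤ) L → SatisfiesHeegnerHypothesis p L →
        NumberField.discr L < -4 → Odd (NumberField.discr L) →
      ∀ (Dt : ModularParametrizationData W (W.conductorNorm ℤ))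
        (Hd : HeegnerDatum (W.conductorNorm ℤ) (NumberField.discr L)) (w₀ : NumberField.InfinitePlace L)
        (PL : (W.baseChange L).toAffine.Point),
        WeierstrassCurve.Affine.Point.map w₀.embedding.toRatAlgHom PL = heegnerPointComplex Dt Hd →
        ¬ (p : ℤ) ∣ Dt.c →
      ∃ (ι' : PadicAlgCl p ≃+* ℂ) (e : L →+* ℚ_[p])
        (κ : ZpExtension L p) (γ : absoluteGaloisGroup L) (ΩK : ℂ) (Ωp : (unrIntegers p)ˣ) (Λf : UnrSeries p),
        (∀ x : 𝓞 L, x ∈ (X11b.primeOfEmbeddingDatum p ι' w₀.embedding).asIdeal ↔ ‖e (x : L)‖ < 1) ∧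
        κ.IsAnticyclotomic ∧ κ.IsTopGenerator γ ∧ ΩK ≠ 0 ∧
        IsBDPLFunction ι' (X11b.primeOfEmbeddingDatum p ι' w₀.embedding) κ γ Dt.f ΩK
          ((Ωp : unrIntegers p) : ℂ_[p]) Λf ∧
        ∃ u : (unrIntegers p)ˣ, Λf.HasValueAt 0
          (((u : unrIntegers p) : ℂ_[p]) *
            (algebraMap ℚ_[p] ℂ_[p]
              (((1 : ℚ_[p]) - (W.LFunction p : ℚ_[p]) * (p : ℚ_[p])⁻¹) * padicLogOmega W p e PL /
                (Dt.c : ℚ_[p]))) ^ 2) := by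
  intro W _ _ p _ _ hX h5 hss _ L _ _ hLq hH hHp _ _ Dt Hd w₀ PL hPL hc
  obtain ⟨ι₀⟩ := PadicAlgCl.nonempty_ringEquiv_complex p
  exact bdpFrameValue_of_thm32 h32 ι₀ W hX h5 hss L hLq hH hHp Dt Hd w₀ PL hc hPL

/-- **A♯ — the anticyclotomic half, ALL of X11b, modulo the named facts `thm32`, `hVC`, (H14), (R)** (door `bdpFrameValue`):
by cases on `Semistable W`. [cite: Castella2018, Thm. 3.2 (arXiv:1704.06608 p. 9)] [cite: Castella2018Exceptional, Thms. 2.10–2.11] -/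
theorem bdpFrameValue (h32 : thm32_exists_isBDPLFunction_valueAtOne)
    (hVC : castella2018Exceptional_bdpValueContinuity_trivialChar)
    (hH14 : hsieh2014_exists_anticyclotomicPAdicLFunction_unrPeriod)
    (hBDP13 : bertoliniDarmonPrasanna2013_centralValue_reciprocity) :
    ∀ (W : WeierstrassCurve ℚ) [W.IsElliptic] [W.IsGloballyMinimal] (p : ℕ) [Fact p.Prime]
      [NeZero (W.conductorNorm ℤ)],
      ClassX11b W p → 5 ≤ p → Surj W p →
      ∀ (L : Type) [Field L] [NumberField L], IsImaginaryQuadratic L →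
        SatisfiesHeegnerHypothesis (W.conductorNorm ℤ) L → SatisfiesHeegnerHypothesis p L →
        NumberField.discr L < -4 → Odd (NumberField.discr L) →
      ∀ (Dt : ModularParametrizationData W (W.conductorNorm ℤ))
        (Hd : HeegnerDatum (W.conductorNorm ℤ) (NumberField.discr L)) (w₀ : NumberField.InfinitePlace L)
        (PL : (W.baseChange L).toAffine.Point),
        WeierstrassCurve.Affine.Point.map w₀.embedding.toRatAlgHom PL = heegnerPointComplex Dt Hd →
        ¬ (p : ℤ) ∣ Dt.c → ¬ IsOfFinAddOrder PL →
      ∃ (ι' : PadicAlgCl p ≃+* ℂ) (e : L →+* ℚ_[p])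
        (κ : ZpExtension L p) (γ : absoluteGaloisGroup L) (ΩK : ℂ) (Ωp : (unrIntegers p)ˣ) (Λf : UnrSeries p),
        (∀ x : 𝓞 L, x ∈ (X11b.primeOfEmbeddingDatum p ι' w₀.embedding).asIdeal ↔ ‖e (x : L)‖ < 1) ∧
        κ.IsAnticyclotomic ∧ κ.IsTopGenerator γ ∧ ΩK ≠ 0 ∧
        IsBDPLFunction ι' (X11b.primeOfEmbeddingDatum p ι' w₀.embedding) κ γ Dt.f ΩK
          ((Ωp : unrIntegers p) : ℂ_[p]) Λf ∧
        ∃ u : (unrIntegers p)ˣ, Λf.HasValueAt 0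
          (((u : unrIntegers p) : ℂ_[p]) *
            (algebraMap ℚ_[p] ℂ_[p]
              (((1 : ℚ_[p]) - (W.LFunction p : ℚ_[p]) * (p : ℚ_[p])⁻¹) * padicLogOmega W p e PL /
                (Dt.c : ℚ_[p]))) ^ 2) := by
  intro W _ _ p _ _ hX h5 hS L _ _ hLq hHg hHp hd4 hodd Dt Hd w₀ PL hPL hc hinf
  by_cases hss : Semistable W
  · exact bdpFrameValue_of_semistable h32 W p hX h5 hss hS L hLq hHg hHp hd4 hodd Dt Hd w₀ PL hPL hc
  · exact bdpFrameValue_of_frame hVC hH14 hBDP13 W p hX h5 hss hS L hLq hHg hHp hd4 hodd Dt Hd w₀ PL hPL hc hinf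

end Summit.BirchSwinnertonDyer.BirchSwinnertonDyer.Theorems.ErratumRoadFiveBstwDoor

end
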